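import Literature.AnabelianGeometry.SemiGraphs.PSCGraphicConverse

/-!
# [CombGC] Proposition 1.5 (ii) ⇐ over the interface, II: incidence and the isomorphism of semi-graphs

Mochizuki, *A combinatorial version of the Grothendieck conjecture*, Tohoku Math. J. **59** (2007)
[CombGC], §1, Proposition 1.5 (ii), author's manuscript p. 13: "`α` is graphic if and only if it is
group-theoretically edge-like and group-theoretically verticial. Moreover, in this case, `α` arises
from a unique isomorphism of semi-graphs of anabelioids `G ⥲ H`."  Sequel of
`PSCGraphicConverse.lean` (abc-iut cell, wave-4 seat abc-iut-w4-d081; proof-only companion of seat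
abc-iut-L3-t4's `PSCGraphicity.lean`): the three bijections `V(𝔾) ≃ V(ℍ)`, `N(𝔾) ≃ N(ℍ)`,
`C(𝔾) ≃ C(ℍ)` induced by a group-theoretically edge-like and verticial `α` are COMPATIBLE WITH THE
COINCIDENCE MAPS, hence assemble to an isomorphism `ι` of the underlying semi-graphs through which `α`
is graphic (Def. 1.4 (i)).

* Cusps (`cuspEnd_eq_of_map`): the vertex of a cusp `c` is read off group-theoretically as the
  unique verticial subgroup containing `Π_c` (Prop. 1.5 (i), cuspidal case, together with the branch
  inclusion `Π_c ↪ Π_v` of Def. 1.1 and Prop. 1.2 (i)); `α` respects this.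
* Nodes (`mem_nodeEnds_iff_exists_le_of_branches`, `nodeEnds_map_eq`): the set of vertices to which a node `e`
  abuts is read off as `{v | Π_e ≤ some conjugate of Π_v}` — PROVIDED the two branch inclusions of
  `e` (Def. 1.1: "each branch of an edge abutting to a vertex gives an inclusion `Π_e ↪ Π_v`") can be
  conjugated into DISTINCT verticial subgroups `γ₁⁻¹Π_{v₁} ≠ γ₂⁻¹Π_{v₂}`, which by Prop. 1.5 (i)
  (non-cuspidal case: "contained in precisely two verticial subgroups") are then ALL the verticial
  overgroups of `Π_e`.  This distinctness — automatic for the data of a pointed stable curve (the two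
  branches of a node, even of a loop, are stabilised by distinct vertices of the universal pro-tree)
  — is NOT recorded by the interface field `PSCDatum.nodeGp_le` and is NOT derivable from the typed
  conclusions of Prop. 1.2 (i) / 1.5 (i) (witness: two vertices `v ≠ w`, one node whose subgroup lies
  in `Π_v` and in `Π_w`; declaring the node a loop at `v` instead of an edge `v — w` changes no
  subgroup and hence no typed predicate, but the two semi-graphs are not isomorphic).  It therefore
  enters every statement below as the explicit inline hypothesis
  `∀ e, ∃ v₁ v₂ γ₁ γ₂, nodeEnds e = s(v₁, v₂) ∧ γ₁ • Π_e ≤ Π_{v₁} ∧ γ₂ • Π_e ≤ Π_{v₂} ∧ γ₁⁻¹ • Π_{v₁} ≠ γ₂⁻¹ • Π_{v₂}`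
  ("distinct branch overgroups"; a sharpening of `PSCDatum.nodeGp_le`, recorded on the cell's
  GAP-LEDGER as row G-w4d081-1 for the interface owner — no new named fact is introduced here).  The
  equivalent "abutment clause" form of the same link (`Π_e ≤ δ Π_u δ⁻¹ ⇒ u ∈ nodeEnds e`, the clause
  of the printed proof of Prop. 1.5 (i), p. 13) and its reduction to loops are seat abc-iut-w4-d110's
  `PSCIncidenceTransport.lean` (`mem_nodeEnds_of_nodeGp_le`, `abutment_of_loops`).
* Assembly: `isGraphic_of_isGroupTheoreticallyEdgeLike_of_isGroupTheoreticallyVerticial` (Prop. 1.5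
  (ii) ⇐), `graphicIffEdgeLikeVerticial_of_incidence` (the full typed `GraphicIffEdgeLikeVerticial`,
  with seat L3-t4's ⇒ and uniqueness), and the printed statement over an origin predicate,
  `graphicIffEdgeLikeVerticialHolds_of_incidence`:
  `OpenInterDeterminesComponentHolds Ω → EdgeLikeIncidenceHolds Ω → (branch link) → GraphicIffEdgeLikeVerticialHolds Ω`
  — i.e. the named fact "Prop. 1.5 (ii)" is a CONSEQUENCE of the named facts "Prop. 1.2 (i)",
  "Prop. 1.5 (i)" and the branch link, for every origin predicate `Ω`.

Pure proofs; no definitions; nothing here takes a side on [IUTchIII] Cor. 3.12.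
-/

noncomputable section

namespace Literature.AnabelianGeometry.SemiGraphs

namespace PSCDatum

open scoped Pointwise

universe u

variable {P : Type u} [Group P] [TopologicalSpace P]
variable {P' : Type u} [Group P'] [TopologicalSpace P']
variable {G : PSCDatum P} {H : PSCDatum P'} {α : P ≃ₜ* P'}

/-! ### Verticial overgroups under `α` -/

/-- If `α(Π_v)` is the conjugate `γᵥ Π'_w`, then `E` lies in a conjugate of `Π_v` iff `α(E)` lies in
a conjugate of `Π'_w` (only the injectivity of `α` on subgroups is used).
[cite: MochizukiCombGC2007, Prop 1.5(ii) p.13] -/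
theorem exists_le_smul_vertGp_iff_map {E : Subgroup P} {v : G.graph.V} {w : H.graph.V} {γv : ConjAct P'}
    (hw : (G.vertGp v).map α.toMulEquiv.toMonoidHom = γv • H.vertGp w) :
    (∃ γ : ConjAct P, E ≤ γ • G.vertGp v) ↔
      ∃ γ' : ConjAct P', E.map α.toMulEquiv.toMonoidHom ≤ γ' • H.vertGp w := by
  have hw' : H.vertGp w = γv⁻¹ • (G.vertGp v).map α.toMulEquiv.toMonoidHom := by
    rw [hw, inv_smul_smul]
  constructor
  · rintro ⟨γ, h⟩
    refine ⟨ConjAct.toConjAct (α.toMulEquiv.toMonoidHom (ConjAct.ofConjAct γ)) * γv, ?_⟩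
    rw [mul_smul, ← hw, ← map_conj_smul]
    exact Subgroup.map_mono h
  · rintro ⟨γ', h⟩
    rw [hw', smul_smul, smul_map_eq_map_smul] at h
    exact ⟨_, (Subgroup.map_le_map_iff_of_injective α.toMulEquiv.injective).1 h⟩

/-! ### Cusps: the vertex of a cusp is its unique verticial overgroup -/

/-- **Incidence of cusps is respected.**  If `α(Π_c) = γ_c Π'_{c'}` and `α(Π_{v(c)}) = γᵥ Π'_w`
(`v(c)` the vertex of the cusp `c`), then `w` is the vertex of `c'`: both `α(γ⁻¹Π_{v(c)})` (from
the branch inclusion `γ Π_c ≤ Π_{v(c)}` of `G`) and a conjugate of `Π'_{v(c')}` (from that of `H`)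
are verticial overgroups of the cuspidal edge-like subgroup `γ_c Π'_{c'}`, which has exactly one
(Prop. 1.5 (i) for `H`); Prop. 1.2 (i) for `H` then identifies the vertices.
[cite: MochizukiCombGC2007, Prop 1.5(ii) p.13] -/
theorem cuspEnd_eq_of_map (hVH : H.VerticialOpenInterDeterminesVertex) (hIH : H.EdgeLikeIncidence)
    {c : G.graph.C} {c' : H.graph.C} {w : H.graph.V} {γc γv : ConjAct P'}
    (hc : (G.cuspGp c).map α.toMulEquiv.toMonoidHom = γc • H.cuspGp c')
    (hw : (G.vertGp (G.graph.cuspEnd c)).map α.toMulEquiv.toMonoidHom = γv • H.vertGp w) :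
    H.graph.cuspEnd c' = w := by
  have hE' : H.IsEdgeLike (γc • H.cuspGp c') := Or.inr ⟨c', γc, rfl⟩
  obtain ⟨B, -, huniq⟩ := ((hIH _ hE').1).1 ⟨c', γc, rfl⟩
  -- the verticial overgroup coming from `G`
  obtain ⟨δ, hδ⟩ := G.cuspGp_le c
  have h₁ : γc • H.cuspGp c' ≤
      (ConjAct.toConjAct (α.toMulEquiv.toMonoidHom (ConjAct.ofConjAct δ)))⁻¹ • γv • H.vertGp w := by
    rw [← hc, ← hw, Subgroup.subset_pointwise_smul_iff, inv_inv, ← map_conj_smul]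
    exact Subgroup.map_mono hδ
  -- the verticial overgroup coming from `H`
  obtain ⟨δ', hδ'⟩ := H.cuspGp_le c'
  have h₂ : γc • H.cuspGp c' ≤ (γc * δ'⁻¹) • H.vertGp (H.graph.cuspEnd c') := by
    rw [mul_smul, Subgroup.pointwise_smul_le_pointwise_smul_iff, Subgroup.subset_pointwise_smul_iff,
      inv_inv]
    exact hδ'
  have e₁ := huniq _ ⟨⟨w, _, smul_smul _ _ _⟩, h₁⟩
  have e₂ := huniq _ ⟨⟨H.graph.cuspEnd c', _, rfl⟩, h₂⟩
  rw [smul_smul] at e₁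
  exact eq_of_smul_vertGp_eq hVH (e₂.trans e₁.symm)

/-! ### Nodes: the vertices of a node are its verticial overgroups -/

/-- **The vertices of a node, group-theoretically.**  Let `e` be a node with `nodeEnds e = s(v₁, v₂)`
whose two branch inclusions `γ₁ Π_e ≤ Π_{v₁}`, `γ₂ Π_e ≤ Π_{v₂}` have DISTINCT targets
`γ₁⁻¹Π_{v₁} ≠ γ₂⁻¹Π_{v₂}` (see the module docstring).  If `G` satisfies the conclusions of
Prop. 1.2 (i) and Prop. 1.5 (i), then a vertex `v` is a vertex of `e` iff `Π_e` lies in a conjugate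
of `Π_v` ("an edge-like subgroup that is not cuspidal is contained in precisely two verticial
subgroups", p. 12 — namely these two). [cite: MochizukiCombGC2007, Prop 1.5(i) p.12] -/
theorem mem_nodeEnds_iff_exists_le_of_branches (hV : G.VerticialOpenInterDeterminesVertex)
    (hE : G.EdgeLikeOpenInterDeterminesEdge) (hI : G.EdgeLikeIncidence) {e : G.graph.N}
    {v₁ v₂ : G.graph.V} {γ₁ γ₂ : ConjAct P} (he : G.graph.nodeEnds e = s(v₁, v₂))
    (h₁ : γ₁ • G.nodeGp e ≤ G.vertGp v₁) (h₂ : γ₂ • G.nodeGp e ≤ G.vertGp v₂)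
    (hne : γ₁⁻¹ • G.vertGp v₁ ≠ γ₂⁻¹ • G.vertGp v₂) (v : G.graph.V) :
    v ∈ G.graph.nodeEnds e ↔ ∃ γ : ConjAct P, G.nodeGp e ≤ γ • G.vertGp v := by
  have h₁' : G.nodeGp e ≤ γ₁⁻¹ • G.vertGp v₁ :=
    Subgroup.subset_pointwise_smul_iff.2 (by rwa [inv_inv])
  have h₂' : G.nodeGp e ≤ γ₂⁻¹ • G.vertGp v₂ :=
    Subgroup.subset_pointwise_smul_iff.2 (by rwa [inv_inv])
  rw [he, Sym2.mem_iff]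
  constructor
  · rintro (rfl | rfl)
    exacts [⟨_, h₁'⟩, ⟨_, h₂'⟩]
  · rintro ⟨γ, hγ⟩
    have hEd : G.IsEdgeLike (G.nodeGp e) := Or.inl ⟨e, 1, (one_smul _ _).symm⟩
    have hnc : ¬ G.IsCuspidal (G.nodeGp e) :=
      not_isCuspidal_of_isNodal hE ⟨e, 1, (one_smul _ _).symm⟩
    obtain ⟨A₁, A₂, hA, hall⟩ := ((hI _ hEd).2).1 hnc
    have m₁ := (hall _).1 ⟨⟨v₁, γ₁⁻¹, rfl⟩, h₁'⟩
    have m₂ := (hall _).1 ⟨⟨v₂, γ₂⁻¹, rfl⟩, h₂'⟩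
    have m := (hall _).1 ⟨⟨v, γ, rfl⟩, hγ⟩
    -- `γ Π_v` is one of the two branch overgroups
    have key : γ • G.vertGp v = γ₁⁻¹ • G.vertGp v₁ ∨ γ • G.vertGp v = γ₂⁻¹ • G.vertGp v₂ := by
      rcases m₁ with rfl | rfl
      · rcases m₂ with h | rfl
        · exact absurd h.symm hne
        · exact m
      · rcases m₂ with rfl | h
        · exact m.symm
        · exact absurd h.symm hne
    rcases key with h | h
    · exact Or.inl (eq_of_smul_vertGp_eq hV h)
    · exact Or.inr (eq_of_smul_vertGp_eq hV h)

/-- **Incidence of nodes is respected.**  With distinct branch overgroups on both sides (see the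
module docstring), Prop. 1.2 (i) and Prop. 1.5 (i) for `G` and `H`, a vertex bijection `φ` matching
the classes of the `Π_v`, and `α(Π_e) = γₑ Π'_{e'}`: the vertices of `e'` are the `φ`-images of the
vertices of `e`. [cite: MochizukiCombGC2007, Prop 1.5(ii) p.13] -/
theorem nodeEnds_map_eq (hVG : G.VerticialOpenInterDeterminesVertex)
    (hEG : G.EdgeLikeOpenInterDeterminesEdge) (hIG : G.EdgeLikeIncidence)
    (hbrG : ∀ e : G.graph.N, ∃ (v₁ v₂ : G.graph.V) (γ₁ γ₂ : ConjAct P),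
      G.graph.nodeEnds e = s(v₁, v₂) ∧ γ₁ • G.nodeGp e ≤ G.vertGp v₁ ∧
        γ₂ • G.nodeGp e ≤ G.vertGp v₂ ∧ γ₁⁻¹ • G.vertGp v₁ ≠ γ₂⁻¹ • G.vertGp v₂)
    (hVH : H.VerticialOpenInterDeterminesVertex) (hEH : H.EdgeLikeOpenInterDeterminesEdge)
    (hIH : H.EdgeLikeIncidence)
    (hbrH : ∀ e' : H.graph.N, ∃ (w₁ w₂ : H.graph.V) (γ₁ γ₂ : ConjAct P'),
      H.graph.nodeEnds e' = s(w₁, w₂) ∧ γ₁ • H.nodeGp e' ≤ H.vertGp w₁ ∧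
        γ₂ • H.nodeGp e' ≤ H.vertGp w₂ ∧ γ₁⁻¹ • H.vertGp w₁ ≠ γ₂⁻¹ • H.vertGp w₂)
    (φ : G.graph.V ≃ H.graph.V)
    (hφ : ∀ v, ∃ γ : ConjAct P', (G.vertGp v).map α.toMulEquiv.toMonoidHom = γ • H.vertGp (φ v))
    {e : G.graph.N} {e' : H.graph.N} {γe : ConjAct P'}
    (he : (G.nodeGp e).map α.toMulEquiv.toMonoidHom = γe • H.nodeGp e') :
    H.graph.nodeEnds e' = (G.graph.nodeEnds e).map φ := by
  obtain ⟨v₁, v₂, γ₁, γ₂, hee, h₁, h₂, hne⟩ := hbrG e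
  obtain ⟨w₁, w₂, δ₁, δ₂, hee', h₁', h₂', hne'⟩ := hbrH e'
  ext w
  rw [Sym2.mem_map, mem_nodeEnds_iff_exists_le_of_branches hVH hEH hIH hee' h₁' h₂' hne' w]
  constructor
  · rintro ⟨γ', hγ'⟩
    refine ⟨φ.symm w, ?_, φ.apply_symm_apply w⟩
    obtain ⟨γv, hγv⟩ := hφ (φ.symm w)
    rw [φ.apply_symm_apply] at hγv
    rw [mem_nodeEnds_iff_exists_le_of_branches hVG hEG hIG hee h₁ h₂ hne, exists_le_smul_vertGp_iff_map hγv, he]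
    exact ⟨γe * γ', by rw [mul_smul]; exact Subgroup.pointwise_smul_le_pointwise_smul_iff.2 hγ'⟩
  · rintro ⟨v, hv, rfl⟩
    obtain ⟨γv, hγv⟩ := hφ v
    rw [mem_nodeEnds_iff_exists_le_of_branches hVG hEG hIG hee h₁ h₂ hne v, exists_le_smul_vertGp_iff_map hγv, he] at hv
    obtain ⟨γ', hγ'⟩ := hv
    exact ⟨γe⁻¹ * γ', by rw [mul_smul]; exact Subgroup.pointwise_smul_subset_iff.1 hγ'⟩

/-! ### Assembly -/

/-- **[CombGC] Proposition 1.5 (ii) ⇐, reduced over the interface**: for data `G`, `H` satisfying the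
conclusions of Prop. 1.2 (i) (verticial and edge-like cases) and of Prop. 1.5 (i), and whose nodes
have distinct branch overgroups (see the module docstring), every group-theoretically edge-like and
group-theoretically verticial `α : Π_G ⥲ Π_H` is GRAPHIC: the bijections of vertices, nodes and
cusps it induces (`PSCGraphicConverse.lean`) respect the coincidence maps (`nodeEnds_map_eq`,
`cuspEnd_eq_of_map`) and `α` carries the class of each `Π_v`, `Π_e`, `Π_c` onto the class of the
corresponding subgroup of `Π_H` (Def. 1.4 (i)). [cite: MochizukiCombGC2007, Prop 1.5(ii) p.13] -/
theorem isGraphic_of_isGroupTheoreticallyEdgeLike_of_isGroupTheoreticallyVerticial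
    (hVG : G.VerticialOpenInterDeterminesVertex) (hEG : G.EdgeLikeOpenInterDeterminesEdge)
    (hIG : G.EdgeLikeIncidence)
    (hbrG : ∀ e : G.graph.N, ∃ (v₁ v₂ : G.graph.V) (γ₁ γ₂ : ConjAct P),
      G.graph.nodeEnds e = s(v₁, v₂) ∧ γ₁ • G.nodeGp e ≤ G.vertGp v₁ ∧
        γ₂ • G.nodeGp e ≤ G.vertGp v₂ ∧ γ₁⁻¹ • G.vertGp v₁ ≠ γ₂⁻¹ • G.vertGp v₂)
    (hVH : H.VerticialOpenInterDeterminesVertex) (hEH : H.EdgeLikeOpenInterDeterminesEdge)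
    (hIH : H.EdgeLikeIncidence)
    (hbrH : ∀ e' : H.graph.N, ∃ (w₁ w₂ : H.graph.V) (γ₁ γ₂ : ConjAct P'),
      H.graph.nodeEnds e' = s(w₁, w₂) ∧ γ₁ • H.nodeGp e' ≤ H.vertGp w₁ ∧
        γ₂ • H.nodeGp e' ≤ H.vertGp w₂ ∧ γ₁⁻¹ • H.vertGp w₁ ≠ γ₂⁻¹ • H.vertGp w₂)
    (he : G.IsGroupTheoreticallyEdgeLike H α) (hv : G.IsGroupTheoreticallyVerticial H α) :
    G.IsGraphic H α := by
  obtain ⟨φ, hφ⟩ := exists_vertEquiv hVG hVH hv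
  obtain ⟨χ, hχ⟩ := exists_nodeEquiv hEG hEH hv he hIG hIH
  obtain ⟨ψ, hψ⟩ := exists_cuspEquiv hEG hEH hv he hIG hIH
  refine ⟨⟨φ, χ, ψ, fun e => ?_, fun c => ?_⟩, hφ, hχ, hψ⟩
  · obtain ⟨γ, hγ⟩ := hχ e
    exact nodeEnds_map_eq hVG hEG hIG hbrG hVH hEH hIH hbrH φ hφ hγ
  · obtain ⟨γc, hγc⟩ := hψ c
    obtain ⟨γv, hγv⟩ := hφ (G.graph.cuspEnd c)
    exact cuspEnd_eq_of_map hVH hIH hγc hγv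

/-- **[CombGC] Proposition 1.5 (ii) as typed** (`GraphicIffEdgeLikeVerticial G H α`: "graphic ⟺
group-theoretically edge-like ∧ group-theoretically verticial", with uniqueness of the isomorphism
of underlying semi-graphs), REDUCED to Prop. 1.2 (i) + Prop. 1.5 (i) for `G` and `H` and the
distinct-branch-overgroups link: "⇒" and uniqueness are seat abc-iut-L3-t4's
(`IsGraphic.isGroupTheoreticallyEdgeLike_and_verticial`, `graphicIffEdgeLikeVerticial_unique_of_openInter`),
"⇐" is the theorem above. [cite: MochizukiCombGC2007, Prop 1.5(ii) p.13] -/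
theorem graphicIffEdgeLikeVerticial_of_incidence
    (hVG : G.VerticialOpenInterDeterminesVertex) (hEG : G.EdgeLikeOpenInterDeterminesEdge)
    (hIG : G.EdgeLikeIncidence)
    (hbrG : ∀ e : G.graph.N, ∃ (v₁ v₂ : G.graph.V) (γ₁ γ₂ : ConjAct P),
      G.graph.nodeEnds e = s(v₁, v₂) ∧ γ₁ • G.nodeGp e ≤ G.vertGp v₁ ∧
        γ₂ • G.nodeGp e ≤ G.vertGp v₂ ∧ γ₁⁻¹ • G.vertGp v₁ ≠ γ₂⁻¹ • G.vertGp v₂)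
    (hVH : H.VerticialOpenInterDeterminesVertex) (hEH : H.EdgeLikeOpenInterDeterminesEdge)
    (hIH : H.EdgeLikeIncidence)
    (hbrH : ∀ e' : H.graph.N, ∃ (w₁ w₂ : H.graph.V) (γ₁ γ₂ : ConjAct P'),
      H.graph.nodeEnds e' = s(w₁, w₂) ∧ γ₁ • H.nodeGp e' ≤ H.vertGp w₁ ∧
        γ₂ • H.nodeGp e' ≤ H.vertGp w₂ ∧ γ₁⁻¹ • H.vertGp w₁ ≠ γ₂⁻¹ • H.vertGp w₂) :
    G.GraphicIffEdgeLikeVerticial H α :=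
  ⟨⟨fun h => h.isGroupTheoreticallyEdgeLike_and_verticial, fun h =>
      isGraphic_of_isGroupTheoreticallyEdgeLike_of_isGroupTheoreticallyVerticial hVG hEG hIG hbrG
        hVH hEH hIH hbrH h.1 h.2⟩,
    graphicIffEdgeLikeVerticial_unique_of_openInter hVH hEH⟩

/-- **[CombGC] Proposition 1.5 (ii), the printed statement over an origin predicate `Ω`**
(`GraphicIffEdgeLikeVerticialHolds Ω`), DERIVED from the printed Prop. 1.2 (i)
(`OpenInterDeterminesComponentHolds Ω`) and Prop. 1.5 (i) (`EdgeLikeIncidenceHolds Ω`) together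
with the distinct-branch-overgroups link for the data singled out by `Ω` (stated inline; for the
intended geometric origin it is part of Def. 1.1 (ii)'s "a vertex (respectively, edge) of `𝔾`
determines, up to conjugation, a closed subgroup", the two branches of a node giving two verticial
subgroups).  Thus, for every `Ω`, the named fact "Prop. 1.5 (ii)" of `PSCGraphicity.lean` is a
consequence of the named facts "Prop. 1.2 (i)", "Prop. 1.5 (i)" and that link.
[cite: MochizukiCombGC2007, Prop 1.5(ii) p.13] -/
theorem graphicIffEdgeLikeVerticialHolds_of_incidence (Ω : PSCOrigin.{u})
    (h12 : OpenInterDeterminesComponentHolds Ω) (h15 : EdgeLikeIncidenceHolds Ω)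
    (hbr : ∀ ⦃Q : Type u⦄ [Group Q] [TopologicalSpace Q] [IsTopologicalGroup Q] (G : PSCDatum Q),
      Ω.IsOfPSCType G → ∀ e : G.graph.N, ∃ (v₁ v₂ : G.graph.V) (γ₁ γ₂ : ConjAct Q),
        G.graph.nodeEnds e = s(v₁, v₂) ∧ γ₁ • G.nodeGp e ≤ G.vertGp v₁ ∧
          γ₂ • G.nodeGp e ≤ G.vertGp v₂ ∧ γ₁⁻¹ • G.vertGp v₁ ≠ γ₂⁻¹ • G.vertGp v₂) :
    GraphicIffEdgeLikeVerticialHolds Ω := by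
  intro Q _ _ _ Q' _ _ _ G H α hG hH
  exact graphicIffEdgeLikeVerticial_of_incidence (h12 G hG).1 (h12 G hG).2.1 (h15 G hG) (hbr G hG)
    (h12 H hH).1 (h12 H hH).2.1 (h15 H hH) (hbr H hH)

end PSCDatum

end Literature.AnabelianGeometry.SemiGraphs

end
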